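import Mathlib
import HarnessLib
import Summits.ValiantsHypothesis.ValiantsHypothesis.Theses.MonotoneRestoration
import Literature.Computability.AlgebraicComplexity.ArithCircuit
import Literature.Computability.AlgebraicComplexity.ArithCircuitProofs
import Literature.Computability.AlgebraicComplexity.MonotoneStructure
import Literature.Computability.AlgebraicComplexity.PermanentIrreducible
import Literature.ModelTheory.FiniteModelTheory.CkEquiv
import Summits.ValiantsHypothesis.ValiantsHypothesis.Theorems.MonotoneRestorationMonotoneRestorationQPCosetCount
import Summits.ValiantsHypothesis.ValiantsHypothesis.Theorems.MonotoneRestorationMonotoneRestorationQPSymmetricLB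
import Summits.ValiantsHypothesis.ValiantsHypothesis.Theorems.MonotoneRestorationMonotoneRestorationQPSupportSymmetrisation
import Summits.ValiantsHypothesis.ValiantsHypothesis.Theorems.MonotoneRestorationMonotoneRestorationQPSparseRegime
import Summits.ValiantsHypothesis.ValiantsHypothesis.Theorems.MonotoneRestorationMonotoneRestorationQPBeta
import Literature.Computability.AlgebraicComplexity.SymmetricArithCircuit
import Literature.Computability.AlgebraicComplexity.DawarWilsenach2025Proofs
import Literature.GroupTheory.PermutationGroups.SmallIndexSubgroups
import Summits.ValiantsHypothesis.ValiantsHypothesis.Theorems.MonotoneRestorationQP.Negative.LoadBearing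
import Summits.ValiantsHypothesis.ValiantsHypothesis.Theorems.MonotoneRestorationMonotoneRestorationQPPermSupportCount

/-! TTRL-lite variant V18989 of stmt-ValiantsHypothesis-15886 -/

-- `ValiantsHypothesis.ValiantsHypothesis`: the D-0017 layout repeats the problem name in the path.
set_option linter.dupNamespace false

namespace Summit.ValiantsHypothesis.ValiantsHypothesis.Theorems

open Summit.ValiantsHypothesis.ValiantsHypothesis.Theses.MonotoneRestoration
open Literature.Computability.AlgebraicComplexity

/-- TTRL-lite variant V18989 (action law at the identity): renaming the variables of a
polynomial in the `n × n` matrix entries along the identity permutation (acting diagonally on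
rows and columns) is the identity map. This is `MvPolynomial.rename_id` after noting that the
renaming function is `id`. -/
theorem stub_altFixing_orbit_dichotomy_var18989 :
    ∀ (n : ℕ) (K : Type) [CommSemiring K] (q : MvPolynomial (Fin n × Fin n) K),
      MvPolynomial.rename
        (fun p : Fin n × Fin n => ((1 : Equiv.Perm (Fin n)) p.1, (1 : Equiv.Perm (Fin n)) p.2)) q = q := by
  intro n K _ q
  have hid : (fun p : Fin n × Fin n =>
      ((1 : Equiv.Perm (Fin n)) p.1, (1 : Equiv.Perm (Fin n)) p.2)) = id := by
    funext p
    simp only [Equiv.Perm.one_apply, id_eq]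
  rw [hid, MvPolynomial.rename_id, AlgHom.id_apply]

end Summit.ValiantsHypothesis.ValiantsHypothesis.Theorems
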